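import Mathlib
import Summits.AtomisticToContinuum.Crystallization.Theorems.ChessboardParticlePlanesLjLaminarWindowsGlueC5
import HarnessLib

/-! # Triple thick-sphere lemma, part A (frame, coordinates, real estimates) — stub `stub_tripleShell`
of line `Sketch` (skeleton rev. 14, lead c8), crux `LjLaminarWindows` (stmt-AtomisticToContinuum-6711)

An orthonormal frame `(e, f, g)` of `ℝ³` adapted to the line `a b` and the third centre `c`; squared
distances in frame coordinates; the real-arithmetic core of the near case (empty triple intersection)
and of the far case (two reference points). -/

noncomputable section

open scoped BigOperators
open Filter Topology
open scoped InnerProductSpace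
open Literature.MathematicalPhysics.StatisticalMechanics
open Summit.AtomisticToContinuum.Crystallization.Theorems.ChargedEnergyGapNegative

namespace Summit.AtomisticToContinuum.Crystallization.Theorems.LjLaminarWindowsSketch

/-- **Adapted orthonormal frame.** For a unit vector `e` and any vector `q` of `ℝ³` there are `f, g`
with `(e, f, g)` orthonormal, the bilinear Parseval identity, `⟪q, g⟫ = 0` and `⟪q, f⟫ ≥ 0`: extend `e`
to an orthonormal basis and rotate the last two vectors by the argument of the projection of `q`.
[folklore] -/
theorem tripleShell_frame (e q : E3) (he : ‖e‖ = 1) :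
    ∃ f g : E3, ⟪e, f⟫_ℝ = 0 ∧ ⟪e, g⟫_ℝ = 0 ∧ ⟪f, g⟫_ℝ = 0 ∧ ⟪f, f⟫_ℝ = 1 ∧ ⟪g, g⟫_ℝ = 1 ∧
      (∀ u v : E3, ⟪u, e⟫_ℝ * ⟪v, e⟫_ℝ + ⟪u, f⟫_ℝ * ⟪v, f⟫_ℝ + ⟪u, g⟫_ℝ * ⟪v, g⟫_ℝ = ⟪u, v⟫_ℝ) ∧
      ⟪q, g⟫_ℝ = 0 ∧ 0 ≤ ⟪q, f⟫_ℝ := by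
  -- an orthonormal basis `b` with `b 0 = e`
  have hcard : Module.finrank ℝ E3 = Fintype.card (Fin 3) := by
    rw [finrank_euclideanSpace_fin, Fintype.card_fin]
  haveI : Subsingleton (↥({0} : Set (Fin 3))) :=
    (Set.subsingleton_coe _).2 Set.subsingleton_singleton
  have hon : Orthonormal ℝ (({0} : Set (Fin 3)).restrict fun _ : Fin 3 => e) := by
    rw [orthonormal_subsingleton_iff]
    intro i
    exact he
  obtain ⟨b, hb⟩ := Orthonormal.exists_orthonormalBasis_extension_of_card_eq hcard hon
  have hb0 : b 0 = e := hb 0 rfl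
  have hO := orthonormal_iff_ite.mp b.orthonormal
  have h01 : ⟪e, b 1⟫_ℝ = 0 := by have h := hO 0 1; rw [hb0, if_neg (by decide)] at h; exact h
  have h02 : ⟪e, b 2⟫_ℝ = 0 := by have h := hO 0 2; rw [hb0, if_neg (by decide)] at h; exact h
  have h12 : ⟪b 1, b 2⟫_ℝ = 0 := by have h := hO 1 2; rw [if_neg (by decide)] at h; exact h
  have h21 : ⟪b 2, b 1⟫_ℝ = 0 := by have h := hO 2 1; rw [if_neg (by decide)] at h; exact h
  have h11 : ⟪b 1, b 1⟫_ℝ = 1 := by have h := hO 1 1; rw [if_pos rfl] at h; exact h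
  have h22 : ⟪b 2, b 2⟫_ℝ = 1 := by have h := hO 2 2; rw [if_pos rfl] at h; exact h
  have hPb : ∀ u v : E3, ⟪u, e⟫_ℝ * ⟪v, e⟫_ℝ + ⟪u, b 1⟫_ℝ * ⟪v, b 1⟫_ℝ +
      ⟪u, b 2⟫_ℝ * ⟪v, b 2⟫_ℝ = ⟪u, v⟫_ℝ := by
    intro u v
    have h := b.sum_inner_mul_inner u v
    rw [Fin.sum_univ_three, hb0] at h
    rw [real_inner_comm e v, real_inner_comm (b 1) v, real_inner_comm (b 2) v]
    exact h
  -- rotate `(b 1, b 2)` by the argument of the projection of `q`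
  obtain ⟨z, hz⟩ : ∃ z : ℂ, z = ⟨⟪q, b 1⟫_ℝ, ⟪q, b 2⟫_ℝ⟩ := ⟨_, rfl⟩
  obtain ⟨ψ, hψ⟩ : ∃ ψ : ℝ, ψ = Complex.arg z := ⟨_, rfl⟩
  have hS : ‖z‖ * Real.cos ψ = ⟪q, b 1⟫_ℝ := by rw [hψ, Complex.norm_mul_cos_arg, hz]
  have hT : ‖z‖ * Real.sin ψ = ⟪q, b 2⟫_ℝ := by rw [hψ, Complex.norm_mul_sin_arg, hz]
  have hsc : Real.sin ψ ^ 2 + Real.cos ψ ^ 2 = 1 := Real.sin_sq_add_cos_sq ψ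
  refine ⟨Real.cos ψ • b 1 + Real.sin ψ • b 2, -Real.sin ψ • b 1 + Real.cos ψ • b 2,
    ?_, ?_, ?_, ?_, ?_, ?_, ?_, ?_⟩
  · simp only [inner_add_right, real_inner_smul_right, h01, h02, mul_zero, add_zero]
  · simp only [inner_add_right, real_inner_smul_right, h01, h02, mul_zero, add_zero]
  · simp only [inner_add_left, inner_add_right, real_inner_smul_left, real_inner_smul_right, h11,
      h12, h21, h22]
    ring
  · simp only [inner_add_left, inner_add_right, real_inner_smul_left, real_inner_smul_right, h11,
      h12, h21, h22]
    linear_combination hsc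
  · simp only [inner_add_left, inner_add_right, real_inner_smul_left, real_inner_smul_right, h11,
      h12, h21, h22]
    linear_combination hsc
  · intro u v
    simp only [inner_add_right, real_inner_smul_right]
    linear_combination hPb u v + (⟪u, b 1⟫_ℝ * ⟪v, b 1⟫_ℝ + ⟪u, b 2⟫_ℝ * ⟪v, b 2⟫_ℝ) * hsc
  · simp only [inner_add_right, real_inner_smul_right]
    linear_combination Real.sin ψ * hS - Real.cos ψ * hT
  · simp only [inner_add_right, real_inner_smul_right]
    have h : Real.cos ψ * ⟪q, b 1⟫_ℝ + Real.sin ψ * ⟪q, b 2⟫_ℝ = ‖z‖ := by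
      linear_combination (-Real.cos ψ) * hS - Real.sin ψ * hT + ‖z‖ * hsc
    rw [h]
    exact norm_nonneg _

/-- **Coordinates in an orthonormal frame.** With `(e, f, g)` orthonormal and Parseval:
`‖v + (l e + μ f + ν g)‖² = (⟪v,e⟫ + l)² + (⟪v,f⟫ + μ)² + (⟪v,g⟫ + ν)²`. [folklore] -/
theorem tripleShell_coord {e f g : E3} (hee : ⟪e, e⟫_ℝ = 1) (hef : ⟪e, f⟫_ℝ = 0) (heg : ⟪e, g⟫_ℝ = 0)
    (hfg : ⟪f, g⟫_ℝ = 0) (hff : ⟪f, f⟫_ℝ = 1) (hgg : ⟪g, g⟫_ℝ = 1)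
    (hP : ∀ u v : E3, ⟪u, e⟫_ℝ * ⟪v, e⟫_ℝ + ⟪u, f⟫_ℝ * ⟪v, f⟫_ℝ + ⟪u, g⟫_ℝ * ⟪v, g⟫_ℝ = ⟪u, v⟫_ℝ)
    (v : E3) (l μ ν : ℝ) :
    ‖v + (l • e + μ • f + ν • g)‖ ^ 2 =
      (⟪v, e⟫_ℝ + l) ^ 2 + (⟪v, f⟫_ℝ + μ) ^ 2 + (⟪v, g⟫_ℝ + ν) ^ 2 := by
  have hfe : ⟪f, e⟫_ℝ = 0 := by rw [real_inner_comm]; exact hef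
  have hge : ⟪g, e⟫_ℝ = 0 := by rw [real_inner_comm]; exact heg
  have hgf : ⟪g, f⟫_ℝ = 0 := by rw [real_inner_comm]; exact hfg
  rw [← real_inner_self_eq_norm_sq, ← hP (v + (l • e + μ • f + ν • g))]
  simp only [inner_add_left, real_inner_smul_left, hee, hef, heg, hfe, hff, hfg, hge, hgf, hgg]
  ring

/-- **Coordinates of a difference.** With Parseval for `(e, f, g)`:
`‖u - v‖² = Σ (⟪u,·⟫ - ⟪v,·⟫)²`. [folklore] -/
theorem tripleShell_coord_sub {e f g : E3}
    (hP : ∀ u v : E3, ⟪u, e⟫_ℝ * ⟪v, e⟫_ℝ + ⟪u, f⟫_ℝ * ⟪v, f⟫_ℝ + ⟪u, g⟫_ℝ * ⟪v, g⟫_ℝ = ⟪u, v⟫_ℝ)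
    (u v : E3) :
    ‖u - v‖ ^ 2 =
      (⟪u, e⟫_ℝ - ⟪v, e⟫_ℝ) ^ 2 + (⟪u, f⟫_ℝ - ⟪v, f⟫_ℝ) ^ 2 + (⟪u, g⟫_ℝ - ⟪v, g⟫_ℝ) ^ 2 := by
  rw [← real_inner_self_eq_norm_sq, ← hP (u - v) (u - v)]
  simp only [inner_sub_left]
  ring

/-- **Square roots are `1/2`-Hölder in squared form:** `(|a| - √u)² ≤ |a² - u|` for all real `a, u`.
[folklore] -/
theorem tripleShell_sqrt (a u : ℝ) : (|a| - Real.sqrt u) ^ 2 ≤ |a ^ 2 - u| := by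
  rcases le_or_gt u 0 with hu | hu
  · rw [Real.sqrt_eq_zero_of_nonpos hu, sub_zero, sq_abs,
      abs_of_nonneg (by linarith [sq_nonneg a] : (0 : ℝ) ≤ a ^ 2 - u)]
    linarith
  · obtain ⟨r, hr0, hru, hr⟩ : ∃ r : ℝ, 0 ≤ r ∧ r ^ 2 = u ∧ Real.sqrt u = r :=
      ⟨Real.sqrt u, Real.sqrt_nonneg u, Real.sq_sqrt hu.le, rfl⟩
    rw [hr]
    have ha := abs_nonneg a
    have h1 : |(|a| - r)| ≤ |a| + r := abs_sub_le_iff.2 ⟨by linarith, by linarith⟩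
    calc (|a| - r) ^ 2 = |(|a| - r)| * |(|a| - r)| := by rw [← sq, sq_abs]
      _ ≤ |(|a| - r)| * (|a| + r) := mul_le_mul_of_nonneg_left h1 (abs_nonneg _)
      _ = |(|a| - r) * (|a| + r)| := by
          rw [abs_mul, abs_of_nonneg (by positivity : (0 : ℝ) ≤ |a| + r)]
      _ = |a ^ 2 - u| := by
          rw [← hru, ← sq_abs a]
          congr 1
          ring

/-- **Scale bookkeeping.** From `L ≥ (1000 K³ / η²) R` with `K ≥ 1`, `0 < η ≤ 1`, `R > 0`:
`1000 K³ R ≤ η² L`, `0 < L`, `R ≤ L`, `η² ≤ 1`, `1000 K R ≤ η² L`. [folklore] -/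
theorem tripleShell_scale {K η L R : ℝ} (hK : 1 ≤ K) (hη0 : 0 < η) (hη1 : η ≤ 1) (hR0 : 0 < R)
    (hL : 1000 * K ^ 3 / η ^ 2 * R ≤ L) :
    1000 * K ^ 3 * R ≤ η ^ 2 * L ∧ 0 < L ∧ R ≤ L ∧ η ^ 2 ≤ 1 ∧ 1000 * (K * R) ≤ η ^ 2 * L := by
  have hη2 : 0 < η ^ 2 := by positivity
  have hη21 : η ^ 2 ≤ 1 := pow_le_one₀ hη0.le hη1
  have hK3 : 1 ≤ K ^ 3 := one_le_pow₀ hK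
  have hL' : 1000 * K ^ 3 * R ≤ η ^ 2 * L := by
    rw [div_mul_eq_mul_div, div_le_iff₀ hη2] at hL
    linarith
  have hL0 : 0 < L :=
    pos_of_mul_pos_right (lt_of_lt_of_le (by positivity) hL') hη2.le
  have hK2 : K ≤ K ^ 3 := by
    have h := mul_le_mul_of_nonneg_left (one_le_pow₀ (n := 2) hK) (by linarith : (0 : ℝ) ≤ K)
    linarith
  refine ⟨hL', hL0, ?_, hη21, ?_⟩
  · linarith [mul_le_mul_of_nonneg_right hη21 hL0.le, mul_le_mul_of_nonneg_right hK3 hR0.le]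
  · linarith [mul_le_mul_of_nonneg_right hK2 hR0.le]

/-- **Common coordinate estimates.** In frame coordinates (`t, α₁, α₂` of `y - m`; `s, w` of `c - m`;
`d = dist a b`), the three shell conditions give `|t| ≤ K R`, `|α₁| ≤ L` and
`|s² + w² - d²/4 - 2 α₁ w| ≤ 3 K L R` (difference of the squared distances to `c` and to `a`).
[folklore] -/
theorem tripleShell_basic {K L R D d s w t α₁ α₂ : ℝ} (hK : 1 ≤ K) (hR0 : 0 < R) (hRL : R ≤ L)
    (hLD : L ≤ K * D) (hDd : D ≤ d) (hca2 : (s + d / 2) ^ 2 + w ^ 2 ≤ (L / 5) ^ 2)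
    (hA1 : (L - R) ^ 2 < (t + d / 2) ^ 2 + α₁ ^ 2 + α₂ ^ 2)
    (hA2 : (t + d / 2) ^ 2 + α₁ ^ 2 + α₂ ^ 2 ≤ L ^ 2)
    (hB1 : (L - R) ^ 2 < (t - d / 2) ^ 2 + α₁ ^ 2 + α₂ ^ 2)
    (hB2 : (t - d / 2) ^ 2 + α₁ ^ 2 + α₂ ^ 2 ≤ L ^ 2)
    (hC1 : (L - R) ^ 2 < (t - s) ^ 2 + (α₁ - w) ^ 2 + α₂ ^ 2)
    (hC2 : (t - s) ^ 2 + (α₁ - w) ^ 2 + α₂ ^ 2 ≤ L ^ 2) :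
    |t| ≤ K * R ∧ |α₁| ≤ L ∧ |s ^ 2 + w ^ 2 - d ^ 2 / 4 - 2 * α₁ * w| ≤ 3 * K * L * R := by
  have hL0 : 0 < L := hR0.trans_le hRL
  have hK0 : 0 < K := by linarith
  have hD0 : 0 < D := pos_of_mul_pos_right (hL0.trans_le hLD) hK0.le
  have hd0 : 0 < d := hD0.trans_le hDd
  -- the axial coordinate
  have h2td : 2 * t * d = ((t + d / 2) ^ 2 + α₁ ^ 2 + α₂ ^ 2) -
      ((t - d / 2) ^ 2 + α₁ ^ 2 + α₂ ^ 2) := by ring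
  have hKdR : L * R ≤ K * R * d := by
    linarith [mul_le_mul_of_nonneg_right hLD hR0.le,
      mul_le_mul_of_nonneg_left hDd (mul_nonneg hK0.le hR0.le)]
  have ht1 : t * d ≤ K * R * d := by linarith [sq_nonneg R]
  have ht2 : -(K * R) * d ≤ t * d := by linarith [sq_nonneg R]
  have ht : |t| ≤ K * R :=
    abs_le.2 ⟨le_of_mul_le_mul_right ht2 hd0, le_of_mul_le_mul_right ht1 hd0⟩
  -- the `f`-coordinate and the position of `c`
  have hα : |α₁| ≤ L :=
    abs_le_of_sq_le_sq (by linarith [sq_nonneg (t + d / 2), sq_nonneg α₂]) hL0.le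
  have hs : |s + d / 2| ≤ L / 5 := abs_le_of_sq_le_sq (by linarith [sq_nonneg w]) (by positivity)
  have hid : s ^ 2 + w ^ 2 - d ^ 2 / 4 - 2 * α₁ * w =
      ((t - s) ^ 2 + (α₁ - w) ^ 2 + α₂ ^ 2 - ((t + d / 2) ^ 2 + α₁ ^ 2 + α₂ ^ 2)) +
        t * (2 * (s + d / 2)) := by ring
  refine ⟨ht, hα, ?_⟩
  rw [hid]
  calc |(t - s) ^ 2 + (α₁ - w) ^ 2 + α₂ ^ 2 - ((t + d / 2) ^ 2 + α₁ ^ 2 + α₂ ^ 2) +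
          t * (2 * (s + d / 2))|
      ≤ |(t - s) ^ 2 + (α₁ - w) ^ 2 + α₂ ^ 2 - ((t + d / 2) ^ 2 + α₁ ^ 2 + α₂ ^ 2)| +
          |t * (2 * (s + d / 2))| := abs_add_le _ _
    _ ≤ 2 * L * R + K * R * (2 * (L / 5)) := by
        refine add_le_add (abs_sub_le_iff.2 ⟨by linarith [sq_nonneg R], by linarith [sq_nonneg R]⟩)
          ?_
        rw [abs_mul, abs_mul, abs_two]
        exact mul_le_mul ht (by linarith) (by positivity) (by positivity)
    _ ≤ 3 * K * L * R := by
        linarith [mul_le_mul_of_nonneg_right hK (mul_nonneg hL0.le hR0.le),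
          mul_nonneg (mul_nonneg hK0.le hL0.le) hR0.le]

/-- **Near case: the triple intersection is empty.** If the third centre is within `40 K R / η²` of
the line `a b` (coordinate `0 ≤ w < 40 K R / η²`), the three shell conditions are incompatible for
`L ≥ (1000 K³/η²) R`: `|s² - d²/4| ≥ 3D²/4` from `dist c a, dist c b ≥ D`, against
`|s² - d²/4| ≤ 3 K L R + 2 L w + w² < D²/4`. [folklore] -/
theorem tripleShell_near {K η L R D d s w t α₁ α₂ : ℝ} (hK : 1 ≤ K) (hη0 : 0 < η) (hη1 : η ≤ 1)
    (hR0 : 0 < R) (hL : 1000 * K ^ 3 / η ^ 2 * R ≤ L) (hLD : L ≤ K * D) (hDd : D ≤ d)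
    (hca1 : D ^ 2 ≤ (s + d / 2) ^ 2 + w ^ 2) (hca2 : (s + d / 2) ^ 2 + w ^ 2 ≤ (L / 5) ^ 2)
    (hcb1 : D ^ 2 ≤ (s - d / 2) ^ 2 + w ^ 2)
    (hA1 : (L - R) ^ 2 < (t + d / 2) ^ 2 + α₁ ^ 2 + α₂ ^ 2)
    (hA2 : (t + d / 2) ^ 2 + α₁ ^ 2 + α₂ ^ 2 ≤ L ^ 2)
    (hB1 : (L - R) ^ 2 < (t - d / 2) ^ 2 + α₁ ^ 2 + α₂ ^ 2)
    (hB2 : (t - d / 2) ^ 2 + α₁ ^ 2 + α₂ ^ 2 ≤ L ^ 2)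
    (hC1 : (L - R) ^ 2 < (t - s) ^ 2 + (α₁ - w) ^ 2 + α₂ ^ 2)
    (hC2 : (t - s) ^ 2 + (α₁ - w) ^ 2 + α₂ ^ 2 ≤ L ^ 2)
    (hw0 : 0 ≤ w) (hw : w < 40 * K * R / η ^ 2) : False := by
  obtain ⟨hL', hL0, hRL, hη21, -⟩ := tripleShell_scale hK hη0 hη1 hR0 hL
  obtain ⟨-, hα, hX⟩ := tripleShell_basic hK hR0 hRL hLD hDd hca2 hA1 hA2 hB1 hB2 hC1 hC2
  have hK0 : 0 < K := by linarith
  have hη2 : 0 < η ^ 2 := by positivity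
  have hD0 : 0 < D := pos_of_mul_pos_right (hL0.trans_le hLD) hK0.le
  -- `1000 K² R ≤ η² D`
  have hKR : 1000 * K ^ 2 * R ≤ η ^ 2 * D := by
    have h1 : η ^ 2 * L ≤ η ^ 2 * (K * D) := mul_le_mul_of_nonneg_left hLD hη2.le
    have h2 : K * (1000 * K ^ 2 * R) ≤ K * (η ^ 2 * D) := by linarith
    exact le_of_mul_le_mul_left h2 hK0
  -- the width `W = 40 K R / η²` is tiny against `D`
  have hKW : K * (40 * K * R / η ^ 2) ≤ D / 25 := by
    rw [show K * (40 * K * R / η ^ 2) = 40 * K ^ 2 * R / η ^ 2 by ring, div_le_iff₀ hη2]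
    linarith
  have hW0 : 0 ≤ 40 * K * R / η ^ 2 := by positivity
  have hWD : 40 * K * R / η ^ 2 ≤ D / 25 := by
    linarith [mul_le_mul_of_nonneg_left hK hW0]
  have hwD : w ≤ D / 25 := by linarith
  have hw2 : w ^ 2 ≤ (D / 25) ^ 2 := pow_le_pow_left₀ hw0 hwD 2
  -- `|s² - d²/4| ≥ 3 D² / 4`
  have h1 : 3 * D ^ 2 / 4 ≤ (s + d / 2) ^ 2 := by linarith [sq_nonneg D]
  have h2 : 3 * D ^ 2 / 4 ≤ (s - d / 2) ^ 2 := by linarith [sq_nonneg D]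
  have h3 : (3 * D ^ 2 / 4) ^ 2 ≤ (s ^ 2 - d ^ 2 / 4) ^ 2 := by
    calc (3 * D ^ 2 / 4) ^ 2 = (3 * D ^ 2 / 4) * (3 * D ^ 2 / 4) := sq _
      _ ≤ (s + d / 2) ^ 2 * (s - d / 2) ^ 2 := mul_le_mul h1 h2 (by positivity) (sq_nonneg _)
      _ = (s ^ 2 - d ^ 2 / 4) ^ 2 := by ring
  have h4 : 3 * D ^ 2 / 4 ≤ |s ^ 2 - d ^ 2 / 4| := by
    have h := sq_le_sq.1 h3
    rwa [abs_of_nonneg (by positivity : (0 : ℝ) ≤ 3 * D ^ 2 / 4)] at h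
  -- the error terms
  have hLW : L * (40 * K * R / η ^ 2) ≤ D * (D / 25) := by
    calc L * (40 * K * R / η ^ 2) ≤ K * D * (40 * K * R / η ^ 2) :=
          mul_le_mul_of_nonneg_right hLD hW0
      _ = D * (K * (40 * K * R / η ^ 2)) := by ring
      _ ≤ D * (D / 25) := mul_le_mul_of_nonneg_left hKW hD0.le
  obtain ⟨hαl, hαu⟩ := abs_le.1 hα
  have hαw1 : α₁ * w ≤ D * (D / 25) := (mul_le_mul hαu hw.le hw0 hL0.le).trans hLW
  have hαw2 : -(D * (D / 25)) ≤ α₁ * w := by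
    have h := (mul_le_mul (by linarith : -α₁ ≤ L) hw.le hw0 hL0.le).trans hLW
    linarith
  have hKLR : K * L * R ≤ D ^ 2 / 1000 := by
    calc K * L * R ≤ K * (K * D) * R := by
          linarith [mul_le_mul_of_nonneg_left hLD (by positivity : (0 : ℝ) ≤ K * R)]
      _ = D * (K ^ 2 * R) := by ring
      _ ≤ D * (η ^ 2 * D / 1000) := mul_le_mul_of_nonneg_left (by linarith) hD0.le
      _ ≤ D ^ 2 / 1000 := by linarith [mul_le_mul_of_nonneg_right hη21 (sq_nonneg D)]
  obtain ⟨hXl, hXu⟩ := abs_le.1 hX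
  have hD2 : 0 < D ^ 2 := by positivity
  rcases le_abs.1 h4 with h | h
  · linarith [sq_nonneg w]
  · linarith

/-- **Far case: the triple intersection is pinned near two points.** If `w ≥ 40 K R / η²`, then with
`γ = (s² + w² - d²/4)/(2w)` and `β = √(L² - d²/4 - γ²)`: every `y` in the three shells has frame
coordinates with `t² + (α₁ - γ)² + (|α₂| - β)² ≤ (η L)²`. [folklore] -/
theorem tripleShell_far :
    ∀ {K η L R D d s w t α₁ α₂ γ β : ℝ}, 1 ≤ K → 0 < η → η ≤ 1 → 0 < R →
      1000 * K ^ 3 / η ^ 2 * R ≤ L → L ≤ K * D → D ≤ d →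
      (s + d / 2) ^ 2 + w ^ 2 ≤ (L / 5) ^ 2 →
      (L - R) ^ 2 < (t + d / 2) ^ 2 + α₁ ^ 2 + α₂ ^ 2 →
      (t + d / 2) ^ 2 + α₁ ^ 2 + α₂ ^ 2 ≤ L ^ 2 →
      (L - R) ^ 2 < (t - d / 2) ^ 2 + α₁ ^ 2 + α₂ ^ 2 →
      (t - d / 2) ^ 2 + α₁ ^ 2 + α₂ ^ 2 ≤ L ^ 2 →
      (L - R) ^ 2 < (t - s) ^ 2 + (α₁ - w) ^ 2 + α₂ ^ 2 →
      (t - s) ^ 2 + (α₁ - w) ^ 2 + α₂ ^ 2 ≤ L ^ 2 →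
      40 * K * R / η ^ 2 ≤ w → γ * (2 * w) = s ^ 2 + w ^ 2 - d ^ 2 / 4 →
      β = Real.sqrt (L ^ 2 - d ^ 2 / 4 - γ ^ 2) →
      t ^ 2 + (α₁ - γ) ^ 2 + (|α₂| - β) ^ 2 ≤ (η * L) ^ 2 := by
  intro K η L R D d s w t α₁ α₂ γ β hK hη0 hη1 hR0 hL hLD hDd hca2 hA1 hA2 hB1 hB2 hC1 hC2 hw hγ hβ
  obtain ⟨-, hL0, hRL, hη21, hKR1⟩ := tripleShell_scale hK hη0 hη1 hR0 hL
  obtain ⟨ht, hα, hX⟩ := tripleShell_basic hK hR0 hRL hLD hDd hca2 hA1 hA2 hB1 hB2 hC1 hC2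
  have hK0 : 0 < K := by linarith
  have hη2 : 0 < η ^ 2 := by positivity
  have hW0 : 0 < 40 * K * R / η ^ 2 := by positivity
  have hw0 : 0 < w := hW0.trans_le hw
  -- `|α₁ - γ| ≤ 3 η² L / 80`
  have hΔ : |α₁ - γ| ≤ 3 * η ^ 2 * L / 80 := by
    have h1 : |α₁ - γ| * (2 * w) ≤ 3 * K * L * R := by
      have h := hX
      rw [show s ^ 2 + w ^ 2 - d ^ 2 / 4 - 2 * α₁ * w = -((α₁ - γ) * (2 * w)) by
        linear_combination -hγ] at h
      rwa [abs_neg, abs_mul, abs_of_pos (by positivity : (0 : ℝ) < 2 * w)] at h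
    have h2 : |α₁ - γ| * (2 * (40 * K * R / η ^ 2)) ≤ 3 * K * L * R :=
      (mul_le_mul_of_nonneg_left (by linarith) (abs_nonneg _)).trans h1
    rw [show |α₁ - γ| * (2 * (40 * K * R / η ^ 2)) = |α₁ - γ| * (80 * K * R) / η ^ 2 by ring,
      div_le_iff₀ hη2] at h2
    have h3 : |α₁ - γ| * (80 * K * R) ≤ 3 * η ^ 2 * L / 80 * (80 * K * R) := by linarith
    exact le_of_mul_le_mul_right h3 (by positivity)
  obtain ⟨hαl, hαu⟩ := abs_le.1 hα
  obtain ⟨hΔl, hΔu⟩ := abs_le.1 hΔ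
  have hη2L : η ^ 2 * L ≤ L := by linarith [mul_le_mul_of_nonneg_right hη21 hL0.le]
  have h5 : |α₁ + γ| ≤ 163 * L / 80 := abs_le.2 ⟨by linarith, by linarith⟩
  have h6 : |α₁ ^ 2 - γ ^ 2| ≤ 3 * η ^ 2 * L / 80 * (163 * L / 80) := by
    rw [show α₁ ^ 2 - γ ^ 2 = (α₁ - γ) * (α₁ + γ) by ring, abs_mul]
    exact mul_le_mul hΔ h5 (abs_nonneg _) (by positivity)
  obtain ⟨h6l, h6u⟩ := abs_le.1 h6
  obtain ⟨htl, htu⟩ := abs_le.1 ht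
  have ht2 : t ^ 2 ≤ (K * R) ^ 2 := sq_le_sq' htl htu
  have hΔ2 : (α₁ - γ) ^ 2 ≤ (3 * η ^ 2 * L / 80) ^ 2 := sq_le_sq' hΔl hΔu
  -- `α₂²` is pinned
  have hu : |α₂ ^ 2 - (L ^ 2 - d ^ 2 / 4 - γ ^ 2)| ≤
      2 * L * R + (K * R) ^ 2 + 3 * η ^ 2 * L / 80 * (163 * L / 80) := by
    refine abs_le.2 ⟨?_, ?_⟩
    · linarith [sq_nonneg R]
    · linarith [sq_nonneg t, mul_pos hL0 hR0, sq_nonneg (K * R)]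
  have hsq : (|α₂| - β) ^ 2 ≤ |α₂ ^ 2 - (L ^ 2 - d ^ 2 / 4 - γ ^ 2)| := by
    rw [hβ]
    exact tripleShell_sqrt _ _
  -- bookkeeping
  have hKR2 : (K * R) ^ 2 ≤ (η ^ 2 * L / 1000) ^ 2 :=
    pow_le_pow_left₀ (by positivity) (by linarith) 2
  have hη4 : η ^ 2 * (η ^ 2 * L ^ 2) ≤ 1 * (η ^ 2 * L ^ 2) :=
    mul_le_mul_of_nonneg_right hη21 (by positivity)
  have hLR2 : L * (1000 * (K * R)) ≤ L * (η ^ 2 * L) := mul_le_mul_of_nonneg_left hKR1 hL0.le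
  have hRK : R ≤ K * R := by
    have h := mul_le_mul_of_nonneg_right hK hR0.le
    linarith
  have hR1 : L * R ≤ L * (K * R) := mul_le_mul_of_nonneg_left hRK hL0.le
  calc t ^ 2 + (α₁ - γ) ^ 2 + (|α₂| - β) ^ 2
      ≤ (K * R) ^ 2 + (3 * η ^ 2 * L / 80) ^ 2 +
          (2 * L * R + (K * R) ^ 2 + 3 * η ^ 2 * L / 80 * (163 * L / 80)) :=
        add_le_add (add_le_add ht2 hΔ2) (hsq.trans hu)
    _ ≤ (η * L) ^ 2 := by linarith

end Summit.AtomisticToContinuum.Crystallization.Theorems.LjLaminarWindowsSketch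

end
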